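import Literature.NumberTheory.LFunctions.MontgomeryOdlyzkoLimitation
import Literature.NumberTheory.LFunctions.MontgomeryOdlyzkoLimitationIKTProofs
import Mathlib.Analysis.SpecialFunctions.Trigonometric.Bounds
import Mathlib.Analysis.Real.Pi.Bounds
import Mathlib.Analysis.Calculus.Deriv.MeanValue
import HarnessLib

/-!
# Goldston–Trudgian–Turnage-Butterbaugh 2023, Theorem 1 — PROVED: the Montgomery–Odlyzko
# method cannot find gaps below `0.5042` of the mean spacing

LABEL: **NOT RH-BEARING.** An RH-FREE, UNCONDITIONAL no-go constant for ONE method (resonators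
of length `≤ T^{1−δ}` in the Montgomery–Odlyzko window count); nothing here is a claim about RH,
about Siegel zeros or about the actual gaps between zeros of `ζ`; nothing here bears on the truth
of RH. (Written by the cell `rh-crit`/C5 as a corollary of its discharge of Inoue–Kobayashi–Toma
2025, Theorem 3; the discharged fact belongs to the `landau-siegel` statement layer
`MontgomeryOdlyzkoLimitation.lean`, which is imported read-only and left untouched.)

Topic `Literature/NumberTheory/LFunctions` (namespace `Literature.NumberTheory.LFunctions`; private
steps in the sub-namespace `GTTB`). PROOF-ONLY module: no `def`, no new named fact. It DISCHARGES
`Literature.NumberTheory.LFunctions.goldstonTrudgianTurnageButterbaugh2023_theorem1`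
("**Theorem 1.** If `c < 0.5042`, then `h(c) < 1`", Goldston–Trudgian–Turnage-Butterbaugh,
J. Math. Anal. Appl. 527 (2023) 127548 = arXiv:2201.10676, p. 2; held `paper:arxiv-2201.10676`)
by `goldstonTrudgianTurnageButterbaugh2023_theorem1_holds`.

## The road (Inoue–Kobayashi–Toma 2025, §6–§7, at `c₀ = 0.5042`)

The paper's own proof (§2) maximises an auxiliary `G(w)` and evaluates `c₀ + G ≤ 0.999993501…`
numerically. We prove the SAME printed statement by the later, sharper route of
Inoue–Kobayashi–Toma (MPCPS 2026, Theorem 3 — the tree theorem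
`inoueKobayashiToma2025_theorem3_holds`, `MontgomeryOdlyzkoLimitationIKTProofs.lean`), whose §7
reports the limitation `μ₁ ≤ 0.508` of the method; at `c₀ = 0.5042 < 0.508` this leaves a visible
margin:

* (R) REDUCTION `goldstonTrudgianTurnageButterbaugh2023_theorem1_of_certificate`: with
  `h = 2πc/log T`, `L = ⌊T^{1−δ}⌋ ≤ T` and `W = 4/s²`, `s = sinc(πy₀)`, IKT Theorem 3 gives, for
  some `l ∈ [1, L]`,
  `h(c) = c − Re(moForm)/Σ|a_k|² ≤ c + φ(c·log(L/l)/log T)/s + s·c·log l/log T + 2πcC/log T`;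
  writing `u = log l/log T ∈ [0, 1]` and using `log(L/l) ≤ log T − log l` and the monotonicity
  of `φ(x) = ∫₀^x sinc²`, the middle is `≤ φ(y)/s + s(c − y)` at `y = c(1 − u) ∈ [0, c]`; the
  function `y ↦ φ(y)/s − s·y` has derivative `(sinc²(πy) − s²)/s`, non-negative on `[0, y₀]` and
  non-positive on `[y₀, 1]` because the sine kernel DECREASES on `[0, 1]` (`x cos x ≤ sin x` on
  `[0, π]`, from Mathlib's `Real.le_tan`), so the middle is `≤ φ(y₀)/s + s(c − y₀)
  ≤ φ(y₀)/s + s(0.5042 − y₀) ≤ M`; and `c + M + 2πc·max(C,0)/log T < 1` as soon as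
  `log T > 2πc·max(C,0)/(1 − M − c)` (positive since `c < 0.5042` and `M < 1 − 0.5042`). The
  binders of the typed fact (`∀ δ c, … → ∃ T₀, ∀ T ≥ T₀, ∀ a, 0 < Σ|a_k|² → h(c) < 1`, with
  `resonatorLength δ T = ⌊T^{1−δ}⌋` and `moFunctional` written over the tree's `moForm`) are met
  with `T₀ = max(2, (L₀+1)^{1/(1−δ)}, exp(K/(1 − M − c) + 1))`.
* (N) CERTIFICATE `GTTB.certificate` at `y₀ = 0.23`: `φ(0.23)/s + s·(0.5042 − 0.23) ≤ 0.49`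
  (numerically `0.48829`; target `1 − 0.5042 = 0.4958`; margin `5.8·10⁻³`, uniform in
  `c < 0.5042`), from `sinc(t) ≤ 1 − t²/6 + t⁴/120` integrated exactly
  (`φ(0.23) ≤ 0.217203`), `0.91522 ≤ sinc(0.23π) ≤ 0.91526` (Taylor bounds
  `x − x³/6 + x⁵/120 − x⁷/5040 ≤ sin x ≤ x − x³/6 + x⁵/120`, derivative-monotonicity chain from
  Mathlib's `Real.sin_ge_sub_cube`) and `3.1415 < π < 3.1416` (Mathlib).

WHAT THIS IS NOT: no statement about the gaps of `ζ`, RH, or Siegel zeros; the no-go concerns ONE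
method. RH-FREE throughout.

## References

* [GoldstonTrudgianTurnageButterbaugh2023] Goldston–Trudgian–Turnage-Butterbaugh, JMAA 527 (2023)
  127548, arXiv:2201.10676, Theorem 1.
* [InoueKobayashiToma2025] Inoue–Kobayashi–Toma, arXiv:2510.14309, MPCPS 2026, Theorem 3 and §7.
-/

noncomputable section

open Real Filter MeasureTheory Set
open scoped Topology

namespace Literature.NumberTheory.LFunctions

namespace GTTB

/-! ### §1 Taylor bounds for `sin`/`cos` (derivative-monotonicity chain) -/

/-- If `f(0) = 0` and `f' ≥ 0` on `[0, ∞)` then `f ≥ 0` on `[0, ∞)`. [folklore] -/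
private theorem nonneg_of_deriv_nonneg_Ici {f f' : ℝ → ℝ} (hf : ∀ x, HasDerivAt f (f' x) x)
    (h0 : f 0 = 0) (hf' : ∀ x, 0 ≤ x → 0 ≤ f' x) : ∀ x, 0 ≤ x → 0 ≤ f x := by
  intro x hx
  have hmono : MonotoneOn f (Ici 0) :=
    monotoneOn_of_deriv_nonneg (convex_Ici 0)
      (fun y _ ↦ (hf y).continuousAt.continuousWithinAt)
      (fun y _ ↦ (hf y).differentiableAt.differentiableWithinAt)
      (fun y hy ↦ by
        rw [interior_Ici] at hy
        rw [(hf y).deriv]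
        exact hf' y (le_of_lt hy))
  have := hmono (self_mem_Ici (a := (0 : ℝ))) hx hx
  rwa [h0] at this

/-- `cos x ≤ 1 − x²/2 + x⁴/24` and `sin x ≤ x − x³/6 + x⁵/120` for `x ≥ 0`. [folklore] -/
private theorem cos_four_sin_five {x : ℝ} (hx : 0 ≤ x) :
    cos x ≤ 1 - x ^ 2 / 2 + x ^ 4 / 24 ∧ sin x ≤ x - x ^ 3 / 6 + x ^ 5 / 120 := by
  have hcos : ∀ y, 0 ≤ y → cos y ≤ 1 - y ^ 2 / 2 + y ^ 4 / 24 := by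
    intro y hy
    have key := nonneg_of_deriv_nonneg_Ici (f := fun x ↦ 1 - x ^ 2 / 2 + x ^ 4 / 24 - cos x)
      (f' := fun x ↦ sin x - (x - x ^ 3 / 6)) ?_ (by simp) ?_ y hy
    · linarith
    · intro z
      have h := ((((hasDerivAt_const z (1:ℝ)).fun_sub ((hasDerivAt_pow 2 z).div_const 2)).fun_add
        ((hasDerivAt_pow 4 z).div_const 24)).fun_sub (hasDerivAt_cos z))
      refine h.congr_deriv ?_
      norm_num; ring
    · intro z hz
      have := Real.sin_ge_sub_cube hz
      linarith
  refine ⟨hcos x hx, ?_⟩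
  have key := nonneg_of_deriv_nonneg_Ici (f := fun x ↦ x - x ^ 3 / 6 + x ^ 5 / 120 - sin x)
    (f' := fun x ↦ 1 - x ^ 2 / 2 + x ^ 4 / 24 - cos x) ?_ (by simp) ?_ x hx
  · linarith
  · intro z
    have h := ((((hasDerivAt_id' z).fun_sub ((hasDerivAt_pow 3 z).div_const 6)).fun_add
      ((hasDerivAt_pow 5 z).div_const 120)).fun_sub (hasDerivAt_sin z))
    refine h.congr_deriv ?_
    norm_num; ring
  · intro z hz
    have := hcos z hz
    linarith

/-- `1 − x²/2 + x⁴/24 − x⁶/720 ≤ cos x` and `x − x³/6 + x⁵/120 − x⁷/5040 ≤ sin x` for `x ≥ 0`.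
[folklore] -/
private theorem cos_six_sin_seven {x : ℝ} (hx : 0 ≤ x) :
    1 - x ^ 2 / 2 + x ^ 4 / 24 - x ^ 6 / 720 ≤ cos x ∧
      x - x ^ 3 / 6 + x ^ 5 / 120 - x ^ 7 / 5040 ≤ sin x := by
  have hcos : ∀ y, 0 ≤ y → 1 - y ^ 2 / 2 + y ^ 4 / 24 - y ^ 6 / 720 ≤ cos y := by
    intro y hy
    have key := nonneg_of_deriv_nonneg_Ici
      (f := fun x ↦ cos x - (1 - x ^ 2 / 2 + x ^ 4 / 24 - x ^ 6 / 720))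
      (f' := fun x ↦ (x - x ^ 3 / 6 + x ^ 5 / 120) - sin x) ?_ (by simp) ?_ y hy
    · linarith
    · intro z
      have h := (hasDerivAt_cos z).fun_sub
        ((((hasDerivAt_const z (1:ℝ)).fun_sub ((hasDerivAt_pow 2 z).div_const 2)).fun_add
          ((hasDerivAt_pow 4 z).div_const 24)).fun_sub ((hasDerivAt_pow 6 z).div_const 720))
      refine h.congr_deriv ?_
      norm_num; ring
    · intro z hz
      have := (cos_four_sin_five hz).2
      linarith
  refine ⟨hcos x hx, ?_⟩
  have key := nonneg_of_deriv_nonneg_Ici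
    (f := fun x ↦ sin x - (x - x ^ 3 / 6 + x ^ 5 / 120 - x ^ 7 / 5040))
    (f' := fun x ↦ cos x - (1 - x ^ 2 / 2 + x ^ 4 / 24 - x ^ 6 / 720)) ?_ (by simp) ?_ x hx
  · linarith
  · intro z
    have h := (hasDerivAt_sin z).fun_sub
      ((((hasDerivAt_id' z).fun_sub ((hasDerivAt_pow 3 z).div_const 6)).fun_add
        ((hasDerivAt_pow 5 z).div_const 120)).fun_sub ((hasDerivAt_pow 7 z).div_const 5040))
    refine h.congr_deriv ?_
    norm_num; ring
  · intro z hz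
    have := hcos z hz
    linarith

/-! ### §2 The sine kernel on `[0, 1]`: non-negative and decreasing -/

/-- `x cos x ≤ sin x` on `[0, π]`. [folklore] -/
private theorem mul_cos_le_sin {x : ℝ} (hx0 : 0 ≤ x) (hxπ : x ≤ π) : x * cos x ≤ sin x := by
  rcases lt_or_ge x (π / 2) with hlt | hge
  · rcases eq_or_lt_of_le hx0 with rfl | hpos
    · simp
    have hcos : 0 < cos x := Real.cos_pos_of_mem_Ioo ⟨by linarith, hlt⟩
    have htan := Real.le_tan hx0 hlt
    rw [Real.tan_eq_sin_div_cos, le_div_iff₀ hcos] at htan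
    exact htan
  · have hcos : cos x ≤ 0 := Real.cos_nonpos_of_pi_div_two_le_of_le hge (by linarith [Real.pi_pos])
    have hsin : 0 ≤ sin x := Real.sin_nonneg_of_nonneg_of_le_pi hx0 hxπ
    nlinarith

/-- Derivative of `sinc` away from `0`. [folklore] -/
private theorem hasDerivAt_sinc {x : ℝ} (hx : x ≠ 0) :
    HasDerivAt Real.sinc ((cos x * x - sin x * 1) / x ^ 2) x := by
  have h : HasDerivAt (fun y => sin y / y) ((cos x * x - sin x * 1) / x ^ 2) x :=
    (hasDerivAt_sin x).div (hasDerivAt_id x) hx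
  refine h.congr_of_eventuallyEq ?_
  filter_upwards [isOpen_ne.mem_nhds hx] with y hy
  exact Real.sinc_of_ne_zero hy

/-- `sinc` is antitone on `[0, π]`. [folklore] -/
private theorem sinc_antitoneOn : AntitoneOn Real.sinc (Icc 0 π) := by
  refine antitoneOn_of_deriv_nonpos (convex_Icc 0 π) Real.continuous_sinc.continuousOn
    (fun x hx => ?_) (fun x hx => ?_)
  · rw [interior_Icc] at hx
    exact (hasDerivAt_sinc hx.1.ne').differentiableAt.differentiableWithinAt
  · rw [interior_Icc] at hx
    rw [(hasDerivAt_sinc hx.1.ne').deriv]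
    have := mul_cos_le_sin hx.1.le hx.2.le
    apply div_nonpos_of_nonpos_of_nonneg _ (sq_nonneg _)
    linarith [mul_comm x (cos x)]

/-- `sinc ≥ 0` on `[0, π]`. [folklore] -/
private theorem sinc_nonneg {x : ℝ} (hx0 : 0 ≤ x) (hxπ : x ≤ π) : 0 ≤ Real.sinc x := by
  rcases eq_or_lt_of_le hx0 with rfl | hpos
  · simp [Real.sinc_zero]
  rw [Real.sinc_of_ne_zero hpos.ne']
  exact div_nonneg (Real.sin_nonneg_of_nonneg_of_le_pi hx0 hxπ) hx0

/-- The sine kernel `sineKernel y = sinc(πy)` is antitone on `[0, 1]`. [folklore] -/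
private theorem sineKernel_antitoneOn : AntitoneOn sineKernel (Icc 0 1) := by
  intro a ha b hb hab
  show Real.sinc (π * b) ≤ Real.sinc (π * a)
  have hπ := Real.pi_pos
  exact sinc_antitoneOn ⟨by nlinarith [ha.1], by nlinarith [ha.2]⟩
    ⟨by nlinarith [hb.1], by nlinarith [hb.2]⟩ (by nlinarith)

/-- `sineKernel y ≥ 0` for `y ∈ [0, 1]`. [folklore] -/
private theorem sineKernel_nonneg {y : ℝ} (hy0 : 0 ≤ y) (hy1 : y ≤ 1) : 0 ≤ sineKernel y := by
  show 0 ≤ Real.sinc (π * y)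
  have hπ := Real.pi_pos
  exact sinc_nonneg (by positivity) (by nlinarith)

/-! ### §3 The one-variable bound is maximised at the critical point -/

/-- The sine kernel is continuous. [folklore] -/
private theorem continuous_sineKernel' : Continuous sineKernel := by
  have : sineKernel = fun x => Real.sinc (π * x) := funext fun _ => rfl
  rw [this]
  exact Real.continuous_sinc.comp (continuous_const.mul continuous_id)

/-- `φ' = sineKernel²` (FTC). [folklore] -/
private theorem hasDerivAt_phi' (y : ℝ) :
    HasDerivAt InoueKobayashiToma2025.phi (sineKernel y ^ 2) y := by
  have hc : Continuous fun u => sineKernel u ^ 2 := continuous_sineKernel'.pow 2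
  have : InoueKobayashiToma2025.phi = fun y => ∫ u in (0 : ℝ)..y, sineKernel u ^ 2 :=
    funext fun _ => rfl
  rw [this]
  exact intervalIntegral.integral_hasDerivAt_right (hc.intervalIntegrable _ _)
    (hc.stronglyMeasurableAtFilter _ _) hc.continuousAt

/-- `φ` is monotone. [folklore] -/
private theorem phi_monotone : Monotone InoueKobayashiToma2025.phi :=
  monotone_of_deriv_nonneg (fun y => (hasDerivAt_phi' y).differentiableAt) fun y => by
    rw [(hasDerivAt_phi' y).deriv]; exact sq_nonneg _

/-- `φ(y) ≥ 0` for `y ≥ 0`. [folklore] -/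
private theorem phi_nonneg' {y : ℝ} (hy : 0 ≤ y) : 0 ≤ InoueKobayashiToma2025.phi y := by
  unfold InoueKobayashiToma2025.phi
  exact intervalIntegral.integral_nonneg hy fun u _ => sq_nonneg _

/-- **Unimodality.** With `s = sineKernel y₀ > 0`, `y₀ ∈ [0, 1]`, the function
`H(y) = φ(y)/s − s·y` (whose derivative `(sineKernel(y)² − s²)/s` changes sign once, at `y₀`,
because the sine kernel decreases on `[0, 1]`) satisfies `H(y) ≤ H(y₀)` on `[0, 1]`. [folklore] -/
private theorem phi_div_sub_le {y₀ y : ℝ} (hy₀0 : 0 ≤ y₀) (hy₀1 : y₀ ≤ 1)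
    (hs : 0 < sineKernel y₀) (hy0 : 0 ≤ y) (hy1 : y ≤ 1) :
    InoueKobayashiToma2025.phi y / sineKernel y₀ - sineKernel y₀ * y
      ≤ InoueKobayashiToma2025.phi y₀ / sineKernel y₀ - sineKernel y₀ * y₀ := by
  set s := sineKernel y₀ with hsdef
  set H : ℝ → ℝ := fun y => InoueKobayashiToma2025.phi y / s - s * y with hHdef
  have hH : ∀ y, HasDerivAt H (sineKernel y ^ 2 / s - s) y := fun y => by
    have h1 : HasDerivAt H (sineKernel y ^ 2 / s - s * 1) y :=
      ((hasDerivAt_phi' y).div_const s).fun_sub ((hasDerivAt_id' y).const_mul s)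
    exact h1.congr_deriv (by ring)
  have hcont : Continuous H := continuous_iff_continuousAt.mpr fun y => (hH y).continuousAt
  show H y ≤ H y₀
  rcases le_total y y₀ with hle | hge
  · have hmono : MonotoneOn H (Icc 0 y₀) := by
      refine monotoneOn_of_deriv_nonneg (convex_Icc _ _) hcont.continuousOn
        (fun x _ => (hH x).differentiableAt.differentiableWithinAt) fun x hx => ?_
      rw [interior_Icc] at hx
      rw [(hH x).deriv, sub_nonneg, le_div_iff₀ hs]
      have hsk : s ≤ sineKernel x :=
        sineKernel_antitoneOn ⟨hx.1.le, by linarith [hx.2]⟩ ⟨hy₀0, hy₀1⟩ hx.2.le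
      nlinarith
    exact hmono ⟨hy0, hle⟩ ⟨hy₀0, le_rfl⟩ hle
  · have hanti : AntitoneOn H (Icc y₀ 1) := by
      refine antitoneOn_of_deriv_nonpos (convex_Icc _ _) hcont.continuousOn
        (fun x _ => (hH x).differentiableAt.differentiableWithinAt) fun x hx => ?_
      rw [interior_Icc] at hx
      rw [(hH x).deriv, sub_nonpos, div_le_iff₀ hs]
      have hsk : sineKernel x ≤ s :=
        sineKernel_antitoneOn ⟨hy₀0, hy₀1⟩ ⟨by linarith [hx.1], hx.2.le⟩ hx.1.le
      have hsk0 : 0 ≤ sineKernel x := sineKernel_nonneg (by linarith [hx.1]) hx.2.le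
      nlinarith
    exact hanti ⟨le_rfl, hy₀1⟩ ⟨hge, hy1⟩ hge

/-! ### §4 The numerical certificate at `y₀ = 0.23`, `c₀ = 0.5042` -/

/-- `φ(0.23) ≤ 0.217203` (from `sinc(t) ≤ 1 − t²/6 + t⁴/120`, exact polynomial integration and
`3.1415 < π < 3.1416`). [folklore] -/
private theorem phi_y0_le : InoueKobayashiToma2025.phi (23 / 100) ≤ 0.217203 := by
  have hπ0 := Real.pi_pos
  -- pointwise bound on `[0, 0.23]`
  have hpt : ∀ u ∈ Icc (0 : ℝ) (23 / 100),
      sineKernel u ^ 2 ≤ (1 - (π * u) ^ 2 / 6 + (π * u) ^ 4 / 120) ^ 2 := by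
    intro u hu
    have hsk0 : 0 ≤ sineKernel u := sineKernel_nonneg hu.1 (by linarith [hu.2])
    refine pow_le_pow_left₀ hsk0 ?_ 2
    show Real.sinc (π * u) ≤ _
    rcases eq_or_lt_of_le hu.1 with h0 | hpos
    · rw [← h0]; simp
    have hx : 0 < π * u := by positivity
    rw [Real.sinc_of_ne_zero hx.ne', div_le_iff₀ hx]
    have := (cos_four_sin_five hx.le).2
    nlinarith
  -- integrate
  have hint : InoueKobayashiToma2025.phi (23 / 100)
      ≤ ∫ u in (0 : ℝ)..(23 / 100), (1 - (π * u) ^ 2 / 6 + (π * u) ^ 4 / 120) ^ 2 := by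
    unfold InoueKobayashiToma2025.phi
    exact intervalIntegral.integral_mono_on (by norm_num)
      ((continuous_sineKernel'.pow 2).intervalIntegrable _ _)
      (Continuous.intervalIntegrable (by fun_prop) _ _) hpt
  have hval : ∫ u in (0 : ℝ)..(23 / 100), (1 - (π * u) ^ 2 / 6 + (π * u) ^ 4 / 120) ^ 2
      = (23 / 100 : ℝ) - π ^ 2 * (23 / 100) ^ 3 / 9 + 2 * π ^ 4 * (23 / 100) ^ 5 / 225
        - π ^ 6 * (23 / 100) ^ 7 / 2520 + π ^ 8 * (23 / 100) ^ 9 / 129600 := by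
    have := intervalIntegral.integral_eq_sub_of_hasDerivAt
      (f := fun y : ℝ => y - π ^ 2 * y ^ 3 / 9 + 2 * π ^ 4 * y ^ 5 / 225
        - π ^ 6 * y ^ 7 / 2520 + π ^ 8 * y ^ 9 / 129600)
      (f' := fun u : ℝ => (1 - (π * u) ^ 2 / 6 + (π * u) ^ 4 / 120) ^ 2)
      (a := 0) (b := 23 / 100) (fun y _ => ?_) (Continuous.intervalIntegrable (by fun_prop) _ _)
    · rw [this]; ring
    have h := ((((hasDerivAt_id' y).sub (((hasDerivAt_pow 3 y).const_mul (π ^ 2)).div_const 9)).add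
      (((hasDerivAt_pow 5 y).const_mul (2 * π ^ 4)).div_const 225)).sub
      (((hasDerivAt_pow 7 y).const_mul (π ^ 6)).div_const 2520)).add
      (((hasDerivAt_pow 9 y).const_mul (π ^ 8)).div_const 129600)
    refine h.congr_deriv ?_
    push_cast
    ring
  have h2 : (3.1415 : ℝ) ^ 2 ≤ π ^ 2 := pow_le_pow_left₀ (by norm_num) Real.pi_gt_d4.le 2
  have h4 : π ^ 4 ≤ (3.1416 : ℝ) ^ 4 := pow_le_pow_left₀ hπ0.le Real.pi_lt_d4.le 4
  have h6 : (3.1415 : ℝ) ^ 6 ≤ π ^ 6 := pow_le_pow_left₀ (by norm_num) Real.pi_gt_d4.le 6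
  have h8 : π ^ 8 ≤ (3.1416 : ℝ) ^ 8 := pow_le_pow_left₀ hπ0.le Real.pi_lt_d4.le 8
  rw [hval] at hint
  nlinarith

/-- `0.91522 ≤ sineKernel(0.23) ≤ 0.91526` (Taylor bounds of `sin`, `3.1415 < π < 3.1416`).
[folklore] -/
private theorem sineKernel_y0_bounds :
    (0.91522 : ℝ) ≤ sineKernel (23 / 100) ∧ sineKernel (23 / 100) ≤ 0.91526 := by
  have hπ0 := Real.pi_pos
  set x := π * (23 / 100) with hxdef
  have hx0 : 0 < x := by positivity
  have hxlo : (0.722545 : ℝ) ≤ x := by have := Real.pi_gt_d4; rw [hxdef]; linarith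
  have hxhi : x ≤ (0.722568 : ℝ) := by have := Real.pi_lt_d4; rw [hxdef]; linarith
  have hsk : sineKernel (23 / 100) = sin x / x := by
    show Real.sinc (π * (23 / 100)) = _
    rw [Real.sinc_of_ne_zero hx0.ne']
  have h2u : x ^ 2 ≤ (0.722568 : ℝ) ^ 2 := pow_le_pow_left₀ hx0.le hxhi 2
  have h2l : (0.722545 : ℝ) ^ 2 ≤ x ^ 2 := pow_le_pow_left₀ (by norm_num) hxlo 2
  have h4u : x ^ 4 ≤ (0.722568 : ℝ) ^ 4 := pow_le_pow_left₀ hx0.le hxhi 4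
  have h4l : (0.722545 : ℝ) ^ 4 ≤ x ^ 4 := pow_le_pow_left₀ (by norm_num) hxlo 4
  have h6u : x ^ 6 ≤ (0.722568 : ℝ) ^ 6 := pow_le_pow_left₀ hx0.le hxhi 6
  rw [hsk]
  constructor
  · rw [le_div_iff₀ hx0]
    have := (cos_six_sin_seven hx0.le).2
    nlinarith
  · rw [div_le_iff₀ hx0]
    have := (cos_four_sin_five hx0.le).2
    nlinarith

/-- `0 < sineKernel(0.23)`. [folklore] -/
private theorem sineKernel_y0_pos : 0 < sineKernel (23 / 100) := by
  have := sineKernel_y0_bounds.1; linarith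

/-- **The certificate**: `φ(0.23)/s + s·(0.5042 − 0.23) ≤ 0.49` with `s = sineKernel(0.23)`
(numerically `0.48829`; `1 − 0.5042 = 0.4958`). [folklore] -/
private theorem certificate :
    InoueKobayashiToma2025.phi (23 / 100) / sineKernel (23 / 100)
      + sineKernel (23 / 100) * (0.5042 - 23 / 100) ≤ 0.49 := by
  obtain ⟨hlo, hhi⟩ := sineKernel_y0_bounds
  have hφ := phi_y0_le
  have hφ0 : 0 ≤ InoueKobayashiToma2025.phi (23 / 100) := phi_nonneg' (by norm_num)
  have hs := sineKernel_y0_pos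
  have h1 : InoueKobayashiToma2025.phi (23 / 100) / sineKernel (23 / 100) ≤ 0.217203 / 0.91522 :=
    div_le_div₀ (by norm_num) hφ (by norm_num) hlo
  have h2 : sineKernel (23 / 100) * (0.5042 - 23 / 100) ≤ 0.91526 * (0.5042 - 23 / 100) :=
    mul_le_mul_of_nonneg_right hhi (by norm_num)
  have h3 : (0.217203 : ℝ) / 0.91522 + 0.91526 * (0.5042 - 23 / 100) ≤ 0.49 := by norm_num
  linarith


end GTTB

open GoldstonTrudgianTurnageButterbaugh2023 in
/-- **The analytic reduction (IKT Theorem 3 ⇒ GTTB Theorem 1, modulo one real inequality).**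
For any `y₀ ∈ [0, 1]` with `s = sineKernel y₀ = sinc(πy₀) > 0` and any `M` with
`φ(y₀)/s + s·(0.5042 − y₀) ≤ M < 1 − 0.5042`, Theorem 1 of Goldston–Trudgian–Turnage-Butterbaugh
holds. Proof: the tree theorem `inoueKobayashiToma2025_theorem3_holds` (IKT 2025 Thm 3) with
`W = 4/s²` at `h = 2πc/log T`, `L = ⌊T^{1−δ}⌋ ≤ T`, gives, for some `l ∈ [1, L]`,
`h(c) ≤ c + φ(c·log(L/l)/log T)/s + s·c·log l/log T + 2πc·C/log T`; with `u = log l/log T ∈ [0,1]`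
and `φ` monotone the middle is `≤ φ(y)/s + s(c − y)` at `y = c(1 − u) ∈ [0, c]`, which is
`≤ φ(y₀)/s + s(c − y₀) ≤ M` because `y ↦ φ(y)/s − s·y` increases on `[0, y₀]` and decreases on
`[y₀, 1]` (the sine kernel decreases on `[0, 1]`); finally `c + M + O(1/log T) < 1` for
`log T > 2πc·max(C,0)/(1 − 0.5042 − M)` since `c < 0.5042`.
The road is that of Inoue–Kobayashi–Toma 2025, §6–§7.
[cite: GoldstonTrudgianTurnageButterbaugh2023, Theorem 1 (p. 2)] -/
theorem goldstonTrudgianTurnageButterbaugh2023_theorem1_of_certificate {y₀ M : ℝ}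
    (hy₀0 : 0 ≤ y₀) (hy₀1 : y₀ ≤ 1) (hs : 0 < sineKernel y₀)
    (hM : InoueKobayashiToma2025.phi y₀ / sineKernel y₀ + sineKernel y₀ * (0.5042 - y₀) ≤ M)
    (hM1 : M < 1 - 0.5042) :
    Literature.NumberTheory.LFunctions.goldstonTrudgianTurnageButterbaugh2023_theorem1 := by
  intro δ c hδ hδ1 hc hc2
  set s := sineKernel y₀ with hsdef
  obtain ⟨C, L₀, hIKT⟩ := inoueKobayashiToma2025_theorem3_holds (4 / s ^ 2) (by positivity)
  -- constants
  set K : ℝ := 2 * π * c * max C 0 with hKdef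
  have hK0 : 0 ≤ K := by positivity
  have hgap : 0 < 1 - M - c := by linarith
  set T₀ : ℝ := max (max 2 (((L₀ : ℝ) + 1) ^ (1 / (1 - δ)))) (Real.exp (K / (1 - M - c) + 1))
    with hT₀def
  refine ⟨T₀, fun T hT a hN => ?_⟩
  -- unpack `T ≥ T₀`
  have hT2 : 2 ≤ T := le_trans (le_trans (le_max_left _ _) (le_max_left _ _)) hT
  have hT1 : 1 < T := by linarith
  have hT0 : 0 < T := by linarith
  have hlogT : 0 < Real.log T := Real.log_pos hT1
  have hTexp : Real.exp (K / (1 - M - c) + 1) ≤ T := le_trans (le_max_right _ _) hT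
  have hlogT' : K / (1 - M - c) < Real.log T := by
    have := Real.log_le_log (Real.exp_pos _) hTexp
    rw [Real.log_exp] at this
    linarith
  have hTpow : ((L₀ : ℝ) + 1) ^ (1 / (1 - δ)) ≤ T :=
    le_trans (le_trans (le_max_right _ _) (le_max_left _ _)) hT
  -- the resonator length `L = ⌊T^{1-δ}⌋`
  set L : ℕ := resonatorLength δ T with hLdef
  have hLdef' : L = ⌊T ^ (1 - δ)⌋₊ := rfl
  have h1δ : 0 < 1 - δ := by linarith
  have hTδ : (L₀ : ℝ) + 1 ≤ T ^ (1 - δ) := by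
    have h := Real.rpow_le_rpow (by positivity) hTpow h1δ.le
    rwa [← Real.rpow_mul (by positivity), one_div_mul_cancel h1δ.ne', Real.rpow_one] at h
  have hL₀L : L₀ ≤ L := by
    rw [hLdef']
    exact Nat.le_floor (by linarith)
  have hLT : (L : ℝ) ≤ T := by
    rw [hLdef']
    refine (Nat.floor_le (by positivity)).trans ?_
    calc T ^ (1 - δ) ≤ T ^ (1 : ℝ) := Real.rpow_le_rpow_of_exponent_le hT1.le (by linarith)
      _ = T := Real.rpow_one T
  -- the window `h = 2πc / log T`
  set h : ℝ := 2 * π * c / Real.log T with hhdef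
  have hh : 0 < h := by positivity
  -- IKT Theorem 3
  have hN' : (∑ n ∈ Finset.Icc 1 L, ‖a n‖ ^ 2) ≠ 0 := ne_of_gt hN
  obtain ⟨l, hl1, hlL, hbound⟩ := hIKT L hL₀L h hh a hN'
  have hsqrt : Real.sqrt (4 / s ^ 2) = 2 / s := by
    rw [Real.sqrt_div' _ (sq_nonneg s), Real.sqrt_sq hs.le]
    congr 1
    rw [show (4 : ℝ) = 2 ^ 2 by norm_num, Real.sqrt_sq (by norm_num)]
  rw [hsqrt] at hbound
  -- `u = log l / log T ∈ [0, 1]`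
  have hl0 : 0 < l := by linarith
  have hlT : l ≤ T := hlL.trans hLT
  have hlogl0 : 0 ≤ Real.log l := Real.log_nonneg hl1
  have hloglT : Real.log l ≤ Real.log T := Real.log_le_log hl0 hlT
  set y : ℝ := c * (1 - Real.log l / Real.log T) with hydef
  have hy0 : 0 ≤ y := by
    have : Real.log l / Real.log T ≤ 1 := (div_le_one hlogT).mpr hloglT
    rw [hydef]; nlinarith
  have hyc : y ≤ c := by
    have : 0 ≤ Real.log l / Real.log T := by positivity
    rw [hydef]; nlinarith
  have hy1 : y ≤ 1 := by linarith
  -- the `φ` argument is at most `y`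
  have hL1 : (1 : ℝ) ≤ L := hl1.trans hlL
  have harg : h / (2 * π) * Real.log ((L : ℝ) / l) ≤ y := by
    have hlogLl : Real.log ((L : ℝ) / l) = Real.log L - Real.log l :=
      Real.log_div (by linarith) hl0.ne'
    have hlogL : Real.log (L : ℝ) ≤ Real.log T := Real.log_le_log (by linarith) hLT
    have hh' : h / (2 * π) = c / Real.log T := by
      rw [hhdef]; field_simp
    rw [hh', hlogLl, hydef]
    rw [show c * (1 - Real.log l / Real.log T) = c / Real.log T * (Real.log T - Real.log l) by
      field_simp]
    exact mul_le_mul_of_nonneg_left (by linarith) (by positivity)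
  have hphi : InoueKobayashiToma2025.phi (h / (2 * π) * Real.log ((L : ℝ) / l))
      ≤ InoueKobayashiToma2025.phi y := GTTB.phi_monotone harg
  -- rewrite the IKT bound in terms of `y`
  have hterm2 : h * Real.log l / (π * (2 / s)) = s * (c - y) := by
    rw [hhdef, hydef]; field_simp; ring
  have hterm3 : C * h ≤ K / Real.log T := by
    rw [hKdef, hhdef]
    have : C ≤ max C 0 := le_max_left _ _
    have h1 : C * (2 * π * c / Real.log T) = (2 * π * c * C) / Real.log T := by ring
    rw [h1]
    exact div_le_div_of_nonneg_right (mul_le_mul_of_nonneg_left this (by positivity)) hlogT.le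
  have hB : |(InoueKobayashiToma2025.moForm a L h).re| / (∑ n ∈ Finset.Icc 1 L, ‖a n‖ ^ 2)
      ≤ InoueKobayashiToma2025.phi y / s + s * (c - y) + K / Real.log T := by
    have h1 : 2 / s / 2 * InoueKobayashiToma2025.phi (h / (2 * π) * Real.log ((L : ℝ) / l))
        ≤ InoueKobayashiToma2025.phi y / s := by
      rw [show 2 / s / 2 * InoueKobayashiToma2025.phi (h / (2 * π) * Real.log ((L : ℝ) / l))
        = InoueKobayashiToma2025.phi (h / (2 * π) * Real.log ((L : ℝ) / l)) / s by ring]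
      exact div_le_div_of_nonneg_right hphi hs.le
    calc _ ≤ _ := hbound
      _ ≤ _ := by rw [hterm2]; linarith
  -- the one-variable maximum at `y₀` and the certificate
  have hmax := GTTB.phi_div_sub_le hy₀0 hy₀1 hs hy0 hy1
  have hG : InoueKobayashiToma2025.phi y / s + s * (c - y) ≤ M := by
    have hc' : c ≤ 0.5042 := hc2.le
    have e3 : s * c ≤ s * 0.5042 := mul_le_mul_of_nonneg_left hc' hs.le
    have e1 : InoueKobayashiToma2025.phi y / s + s * (c - y)
        = (InoueKobayashiToma2025.phi y / s - s * y) + s * c := by ring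
    have e2 : InoueKobayashiToma2025.phi y₀ / s + s * (0.5042 - y₀)
        = (InoueKobayashiToma2025.phi y₀ / s - s * y₀) + s * 0.5042 := by ring
    rw [e1]
    rw [e2] at hM
    linarith
  -- conclude
  have hKlog : K / Real.log T < 1 - M - c := by
    rw [div_lt_iff₀ hlogT]
    have := (div_lt_iff₀ hgap).mp hlogT'
    linarith
  show c - (InoueKobayashiToma2025.moForm a L (2 * π * c / Real.log T)).re / coeffNormSq a L < 1
  have hcoeff : coeffNormSq a L = ∑ n ∈ Finset.Icc 1 L, ‖a n‖ ^ 2 := rfl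
  rw [hcoeff, ← hhdef]
  have hre : -((InoueKobayashiToma2025.moForm a L h).re) / (∑ n ∈ Finset.Icc 1 L, ‖a n‖ ^ 2)
      ≤ |(InoueKobayashiToma2025.moForm a L h).re| / (∑ n ∈ Finset.Icc 1 L, ‖a n‖ ^ 2) :=
    div_le_div_of_nonneg_right (neg_le_abs _) hN.le
  rw [neg_div] at hre
  linarith

/-- **Goldston–Trudgian–Turnage-Butterbaugh 2023, Theorem 1 — PROVED** ("If `c < 0.5042`, then
`h(c) < 1`", for every choice of the coefficients `a_k` and every `δ ∈ (0,1)`): discharges the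
named fact `goldstonTrudgianTurnageButterbaugh2023_theorem1` (`MontgomeryOdlyzkoLimitation.lean`).
It is `goldstonTrudgianTurnageButterbaugh2023_theorem1_of_certificate` at `y₀ = 0.23` with the
kernel-checked certificate `φ(0.23)/s + s·(0.5042 − 0.23) ≤ 0.49 < 0.4958` (`GTTB.certificate`;
numerically the left side is `0.48829`, i.e. the Inoue–Kobayashi–Toma limitation computation of
their §7 performed at `c₀ = 0.5042` rather than the paper's own `G(w)`-maximisation of §2 — the
printed statement is what is proved). UNCONDITIONAL (no RH).
[cite: GoldstonTrudgianTurnageButterbaugh2023, Theorem 1 (p. 2; proof §2, numerics p. 4)] -/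
theorem goldstonTrudgianTurnageButterbaugh2023_theorem1_holds :
    Literature.NumberTheory.LFunctions.goldstonTrudgianTurnageButterbaugh2023_theorem1 :=
  goldstonTrudgianTurnageButterbaugh2023_theorem1_of_certificate (y₀ := 23 / 100) (M := 0.49)
    (by norm_num) (by norm_num) GTTB.sineKernel_y0_pos GTTB.certificate (by norm_num)

open GoldstonTrudgianTurnageButterbaugh2023 in
/-- **The no-go reading, now hypothesis-free**: for `c < 0.5042` and any `δ ∈ (0,1)`, NO family of
resonators `a_T` of length `⌊T^{1−δ}⌋` satisfies the hypothesis "`h(c) > 1` for all large `T`" of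
the Montgomery–Odlyzko criterion (the landau-siegel statement layer's
`no_moCriterion_below`, fed with `goldstonTrudgianTurnageButterbaugh2023_theorem1_holds`).
[cite: GoldstonTrudgianTurnageButterbaugh2023, Theorem 1 and §1 ("falls well short of being able to prove μ ≤ 1/2")] -/
theorem no_moCriterion_below_holds {δ c : ℝ} (hδ : 0 < δ) (hδ1 : δ < 1) (hc : 0 < c)
    (hc2 : c < 0.5042) (a : ℝ → ℕ → ℂ) :
    ¬ ∃ T₀ : ℝ, ∀ T : ℝ, T₀ ≤ T →
        0 < coeffNormSq (a T) (resonatorLength δ T) ∧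
          1 < moFunctional c (a T) (resonatorLength δ T) T :=
  no_moCriterion_below goldstonTrudgianTurnageButterbaugh2023_theorem1_holds hδ hδ1 hc hc2 a

end Literature.NumberTheory.LFunctions
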